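import Summits.QuantumFields.YangMills.Theorems.BalabanUVNodesN08HaarCompatibilityGuardJacobian

/-!
# BalabanUVNodes ∕ N08 — FRAME CALCULUS FOR THE SHARP JACOBIAN BOUND OF THE PRINTED exp-mean-log FIBRE MAP:
# the perspective inequality `φ(β) ≥ μ·φ(β∕μ) + (1−μ)·β∕sin β` (concavity of `sin`), the half-point ratio
# `e^{(p+q)∕2} ∕ dd(p,q) = β∕sin β`, and the quadratic forms of the solutions of `dexp Z H = R` in an eigenframe of `Z`

WIDTH SEAT `pub-ymgap-dag-n08-w6` g3 (R399 (3a) second wave; self-located CLAIM-1 of record HOME INBOX l.29757, conjecture's author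
dag-n08-w3 g4 «NOT MINE: GO» l.29792), 2026-08-28.  Track A, DAG node N08 = [Balaban1985UV3] Thm 1 p. 257 (compact) + Thm 2 p. 272;
key item K1⁷ `StabilityBAtRecordR13SepCoPH` (stmt-QuantumFields-20542), `--supports … --as helper`.  COUNT-NEUTRAL.  Part 1 of 2 (split at
the 400-line lint): the [folklore] matrix∕trigonometric lemmas; part 2 `…GuardJacobianSharp` proves the sharp coercivity with them.

THE POINT.  Width seat n08-w3's `…GuardJacobian` (p607823) bounds the tangent map `D K_W` of the printed exp-mean-log fibre map
`K_W = exp(Σᵢ cᵢ log(hᵢW*))·W` below by `(1 − Σcᵢ)·sin ρ∕ρ` and records the CONJECTURE that the sharp constant is `1 − Σcᵢ` (attained at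
the flat background, `emlD_flat`).  In a unitary eigenframe `Y = U diag(−iθ) U*` of `Y = Σcᵢ log(hᵢW*)` every operator of the problem is
an entrywise multiplier in the half-angles `β_{ab} = (θₐ − θ_b)∕2`: `dexp Y ↔ dd(−iθₐ,−iθ_b)` (modulus `sin β∕β`), the solution `H_Y` of
`dexp(Y)H = exp(Y)X` has `hs(X, H_Y) = Σ|X'_{ab}|²·β cot β` (`= 1 − ψ(β)`, pub-balaban's `dd_ratio`), and — new here — the FLAT solution
`G♭` of `dexp(Y)G♭ = e^{Y∕2} X e^{Y∕2}` has `hs(X, G♭) = Σ|X'_{ab}|²·β∕sin β` (`exp_half_div_dd`): the quadratic form of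
`χ(B_Y) = |dexp Y|⁻¹∘(unitary)`, `χ ≥ 1`.  The one scalar inequality the sharp bound needs is the PERSPECTIVE inequality
`(1 − μ)·β∕sin β ≤ β cot β − μ·(β∕μ)cot(β∕μ)` (`|β| ≤ μ ≤ 1`), which after clearing denominators is `(1−μ)·sin t ≤ sin((1−μ)t)`,
`t = β∕μ ∈ [0, π]` — the concavity of `sin` (`persp_scalar`).  Finally a twisted Cauchy–Schwarz (`hs_sq_le_frame`): pairing `dexp Y G'`
with `(dexp Y)^{−*}X` (frame coordinates `X'∕conj dd`, Hilbert–Schmidt norm `= ‖G♭‖`) gives `hs(X,G')² ≤ hs(G♭,G♭)·hs(dexp Y G', dexp Y G')`.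

WHAT THIS FILE PROVES ([folklore] real∕matrix analysis over `T4EMLTangentInjective` + `…GuardJacobian`; nothing of Bałaban's asserted; 0 `def`).
§1 `mul_sin_le_sin_mul` · `persp_scalar_pos` · ★ `persp_scalar`.  §2 `mul_exp_of_eigen` · `dd_eq_exp_half_mul` · ★ `exp_half_div_dd` · `norm_dd_eq`
(`|dd(−iθₐ,−iθ_b)| = sinc β` exactly) · `coef_of_dexp_eq_frame` · `hs_of_dexp_eq_frame` · `exp_mul_frame` · `exp_half_sandwich_frame` · ★ `hs_solution_eq`
· ★ `hs_flat_solution_eq` · `hs_self_le_hs_flat_solution` (`hs(X,X) ≤ hs(X,G♭)`) · ★ `hs_sq_le_frame`.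

HONEST FRAMING.  Kernel matrix analysis about the printed formula (0.4) ∕ (1.4); count-neutral helper; E6′ NOT decided; `hmass` NOT supplied; N08 NOT
discharged; counts unmoved (typed 28∕28 · discharged 5∕27); no summit statement is proved by this seat — one finite 𝕋⁴ programme at fixed ε, R4 closes
the CONDITIONAL rung `BalabanLadder.UV` only; the Yang–Mills mass gap (Clay) is NOT proved by any of this; nothing continuum ∕ ℝ⁴ ∕ OS ∕ mass gap.
0 `sorry`, 0 `def`, 0 `instance`, 0 `notation`, standard axioms.
-/

noncomputable section

open NormedSpace Finset
open scoped Matrix Matrix.Norms.L2Operator ComplexConjugate Nat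

namespace Summit.QuantumFields.YangMills.BalabanUVNodes.N08HaarCompatibilityGuardJacobianSharpFrame

open Literature.MathematicalPhysics.QuantumFieldTheory.Balaban1983to89
open Literature.MathematicalPhysics.QuantumFieldTheory.Balaban1983to89.T4EMLTangentInjective
open Summit.QuantumFields.YangMills.BalabanUVNodes.N08HaarCompatibilityGuardJacobian
open Matrix (single diagonal unitaryGroup)
open Complex (I)
open T4QuatExpLog (ψ ψ_zero ψ_of_ne_zero)

variable {m : Type*} [Fintype m]

/-! ## §1 Two scalar facts: concavity of `sin`, and the perspective inequality for `β cot β` -/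

omit [Fintype m] in
/-- **Concavity of `sin` on `[0, π]` in chord form**: `l · sin t ≤ sin (l · t)` for `0 ≤ l ≤ 1`, `0 ≤ t ≤ π`. [folklore] -/
theorem mul_sin_le_sin_mul {l t : ℝ} (hl0 : 0 ≤ l) (hl1 : l ≤ 1) (ht0 : 0 ≤ t) (htπ : t ≤ Real.pi) :
    l * Real.sin t ≤ Real.sin (l * t) := by
  have hconc := strictConcaveOn_sin_Icc.concaveOn
  have h1 : t ∈ Set.Icc 0 Real.pi := ⟨ht0, htπ⟩
  have h0 : (0 : ℝ) ∈ Set.Icc 0 Real.pi := ⟨le_rfl, Real.pi_pos.le⟩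
  have key := hconc.2 h1 h0 hl0 (sub_nonneg.2 hl1) (by ring)
  simpa only [smul_eq_mul, mul_zero, add_zero, Real.sin_zero] using key

omit [Fintype m] in
/-- The perspective inequality behind the sharp constant, for `0 < β ≤ μ ≤ 1`:
`(1 − μ)·β∕sin β ≤ β cot β − μ·(β∕μ) cot(β∕μ)` — after clearing denominators it is
`(1 − μ)·sin(β∕μ) ≤ sin((1 − μ)·β∕μ)`, the concavity of `sin`. [folklore] -/
theorem persp_scalar_pos {μ β : ℝ} (hβ : 0 < β) (hβμ : β ≤ μ) (hμ1 : μ ≤ 1) :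
    (1 - μ) * (Real.sinc β)⁻¹ ≤ (1 - ψ β) - μ * (1 - ψ (β / μ)) := by
  have hμ : 0 < μ := hβ.trans_le hβμ
  have hπ3 : (3 : ℝ) < Real.pi := Real.pi_gt_three
  set t : ℝ := β / μ with ht
  have ht0 : 0 < t := div_pos hβ hμ
  have ht1 : t ≤ 1 := (div_le_one hμ).2 hβμ
  have hβ1 : β ≤ 1 := hβμ.trans hμ1
  have hsβ : 0 < Real.sin β := Real.sin_pos_of_pos_of_lt_pi hβ (by linarith)
  have hst : 0 < Real.sin t := Real.sin_pos_of_pos_of_lt_pi ht0 (by linarith)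
  have hμt : μ * t = β := by rw [ht]; field_simp
  rw [Real.sinc_of_ne_zero hβ.ne', inv_div, ψ_of_ne_zero hβ.ne', ψ_of_ne_zero ht0.ne', sub_sub_cancel, sub_sub_cancel]
  have key : Real.sin ((1 - μ) * t) = Real.sin t * Real.cos β - Real.cos t * Real.sin β := by
    rw [show (1 - μ) * t = t - β by rw [← hμt]; ring, Real.sin_sub]
  have hconc : (1 - μ) * Real.sin t ≤ Real.sin ((1 - μ) * t) :=
    mul_sin_le_sin_mul (by linarith) (by linarith) ht0.le (by linarith)
  have hdiff : β * Real.cos β / Real.sin β - μ * (t * Real.cos t / Real.sin t) - (1 - μ) * (β / Real.sin β)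
      = β * (Real.sin ((1 - μ) * t) - (1 - μ) * Real.sin t) / (Real.sin β * Real.sin t) := by
    rw [key, show μ * (t * Real.cos t / Real.sin t) = β * Real.cos t / Real.sin t by
      rw [← hμt]; field_simp]
    field_simp
  have hnn : 0 ≤ β * (Real.sin ((1 - μ) * t) - (1 - μ) * Real.sin t) / (Real.sin β * Real.sin t) :=
    div_nonneg (mul_nonneg hβ.le (sub_nonneg.2 hconc)) (mul_pos hsβ hst).le
  linarith

omit [Fintype m] in
/-- The perspective inequality for `|β| ≤ μ ≤ 1` (even in `β`; at `β = 0` it is the identity `1 − μ = 1 − μ`):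
`(1 − μ)·(sinc β)⁻¹ ≤ (1 − ψ β) − μ·(1 − ψ(β∕μ))`, `1 − ψ β = β cot β`. [folklore] -/
theorem persp_scalar {μ β : ℝ} (hβμ : |β| ≤ μ) (hμ1 : μ ≤ 1) :
    (1 - μ) * (Real.sinc β)⁻¹ ≤ (1 - ψ β) - μ * (1 - ψ (β / μ)) := by
  rcases lt_trichotomy β 0 with hβ | hβ | hβ
  · have h := persp_scalar_pos (neg_pos.2 hβ) (by rwa [abs_of_neg hβ] at hβμ) hμ1
    rwa [Real.sinc_neg, ψ_neg, neg_div, ψ_neg] at h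
  · subst hβ
    simp [Real.sinc_zero, ψ_zero]
  · exact persp_scalar_pos hβ (by rwa [abs_of_pos hβ] at hβμ) hμ1

/-! ## §2 Frame calculus: right eigen-relation of `exp`, the half-point ratio of the divided difference, solutions of
`dexp Z H = R` in a unitary eigenframe of `Z` -/

variable [DecidableEq m]

/-- `F exp Z = e^q F` if `F Z = q F`. [folklore] -/
theorem mul_exp_of_eigen {Z F : Matrix m m ℂ} {q : ℂ} (hr : F * Z = q • F) : F * exp Z = Complex.exp q • F := by
  have h1 : HasSum (fun n : ℕ => F * ((n !⁻¹ : ℂ) • Z ^ n)) (F * exp Z) :=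
    (NormedSpace.exp_series_hasSum_exp' (𝕂 := ℂ) Z).mul_left F
  have h2 : HasSum (fun n : ℕ => ((n !⁻¹ : ℂ) * q ^ n) • F) (Complex.exp q • F) :=
    (hasSum_exp_scalar q).smul_const F
  have h3 : (fun n : ℕ => F * ((n !⁻¹ : ℂ) • Z ^ n)) = fun n => ((n !⁻¹ : ℂ) * q ^ n) • F := by
    funext n; rw [mul_smul_comm, mul_pow_of_eigen hr, smul_smul]
  rw [h3] at h1
  exact h1.unique h2

omit [Fintype m] [DecidableEq m] in
/-- **The divided difference at purely imaginary nodes, factored at the midpoint**: for `p = −iθₐ`, `q = −iθ_b`,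
`β = (θₐ − θ_b)∕2 ≠ 0`: `dd(p, q) = e^{(p+q)∕2} · (sin β ∕ β)`. [folklore] -/
theorem dd_eq_exp_half_mul {θa θb : ℝ} (hne : θa ≠ θb) :
    dd (-I * θa) (-I * θb) = Complex.exp ((-I * θa + -I * θb) / 2) *
      (((Real.sin ((θa - θb) / 2) / ((θa - θb) / 2) : ℝ)) : ℂ) := by
  set β : ℝ := (θa - θb) / 2 with hβdef
  set s : ℂ := (-I * θa + -I * θb) / 2 with hs
  have hβ0 : β ≠ 0 := by rw [hβdef]; intro h; apply hne; linarith [div_eq_zero_iff.1 h]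
  have hpq : (-I * θa : ℂ) ≠ -I * θb := by
    intro h
    have := mul_left_cancel₀ (neg_ne_zero.2 Complex.I_ne_zero) h
    exact hne (Complex.ofReal_injective this)
  have hp : (-I * θa : ℂ) = s + (-(β : ℂ)) * I := by rw [hs, hβdef]; push_cast; ring
  have hq : (-I * θb : ℂ) = s + (β : ℂ) * I := by rw [hs, hβdef]; push_cast; ring
  have hsub : (-I * θa : ℂ) - -I * θb = -2 * (β : ℂ) * I := by rw [hβdef]; push_cast; ring
  rw [dd, if_neg hpq, hsub]
  conv_lhs => rw [hp, hq]
  rw [Complex.exp_add, Complex.exp_add, Complex.exp_mul_I, Complex.exp_mul_I, Complex.cos_neg, Complex.sin_neg]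
  push_cast
  rw [← Complex.ofReal_sin, ← Complex.ofReal_cos]
  have hβc : (β : ℂ) ≠ 0 := Complex.ofReal_ne_zero.2 hβ0
  field_simp
  ring

omit [Fintype m] [DecidableEq m] in
/-- **The half-point ratio is `β ∕ sin β`**: `e^{(p+q)∕2} ∕ dd(p, q) = (sinc β)⁻¹` (real, `≥ 1`) for `p = −iθₐ`, `q = −iθ_b`,
`β = (θₐ − θ_b)∕2`, `|β| < π`. [folklore] -/
theorem exp_half_div_dd {θa θb : ℝ} (hβ : |(θa - θb) / 2| < Real.pi) :
    Complex.exp ((-I * θa + -I * θb) / 2) / dd (-I * θa) (-I * θb) = (((Real.sinc ((θa - θb) / 2))⁻¹ : ℝ) : ℂ) := by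
  by_cases hab : θa = θb
  · subst hab
    have h0 : (θa - θa) / 2 = 0 := by simp
    rw [dd, if_pos rfl, h0, Real.sinc_zero, show (-I * (θa : ℂ) + -I * θa) / 2 = -I * θa by ring,
      div_self (Complex.exp_ne_zero _)]
    simp
  · set β : ℝ := (θa - θb) / 2 with hβdef
    have hβ0 : β ≠ 0 := by rw [hβdef]; intro h; apply hab; linarith [div_eq_zero_iff.1 h]
    have hsin : Real.sin β ≠ 0 := by
      intro h0
      rw [Real.sin_eq_zero_iff_of_lt_of_lt (by linarith [(abs_lt.1 hβ).1]) (abs_lt.1 hβ).2] at h0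
      exact hβ0 h0
    rw [dd_eq_exp_half_mul hab, Real.sinc_of_ne_zero hβ0, inv_div]
    have he := Complex.exp_ne_zero ((-I * θa + -I * θb) / 2)
    have h1 : (((Real.sin β / β : ℝ)) : ℂ) ≠ 0 := Complex.ofReal_ne_zero.2 (div_ne_zero hsin hβ0)
    rw [div_mul_eq_div_div, div_self he, one_div, ← Complex.ofReal_inv, inv_div]

omit [Fintype m] [DecidableEq m] in
/-- `|dd(−iθₐ, −iθ_b)| = sinc β` exactly, `β = (θₐ − θ_b)∕2`, `|β| < π` (cf. the lower bound `norm_dd_ge`). [folklore] -/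
theorem norm_dd_eq {θa θb : ℝ} (hβ : |(θa - θb) / 2| < Real.pi) :
    ‖dd (-I * θa) (-I * θb)‖ = Real.sinc ((θa - θb) / 2) := by
  by_cases hab : θa = θb
  · subst hab
    have h0 : (θa - θa) / 2 = 0 := by simp
    rw [dd, if_pos rfl, h0, Real.sinc_zero, Complex.norm_exp]
    simp
  · set β : ℝ := (θa - θb) / 2 with hβdef
    have hβ0 : β ≠ 0 := by rw [hβdef]; intro h; apply hab; linarith [div_eq_zero_iff.1 h]
    have hsinc : 0 ≤ Real.sinc β := by
      rw [Real.sinc_of_ne_zero hβ0]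
      rcases lt_or_gt_of_ne hβ0 with hn | hp
      · have := Real.sin_neg_of_neg_of_neg_pi_lt hn (by linarith [(abs_lt.1 hβ).1])
        exact (div_pos_of_neg_of_neg this hn).le
      · exact (div_pos (Real.sin_pos_of_pos_of_lt_pi hp (abs_lt.1 hβ).2) hp).le
    rw [dd_eq_exp_half_mul hab, norm_mul, Complex.norm_exp, ← Real.sinc_of_ne_zero hβ0, Complex.norm_real,
      Real.norm_of_nonneg hsinc]
    have : ((-I * (θa : ℂ) + -I * θb) / 2).re = 0 := by simp
    rw [this, Real.exp_zero, one_mul]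


section Frame

variable [Nonempty m]

/-- **Frame coefficients of a solution of `dexp Z H = R`** in a unitary eigenframe `Z = U diag(−iθ) U*`: if the right side
has frame coordinates `R'_{ab} = r_{ab}·X'_{ab}` (`X' = U* X U`), then `dd(−iθₐ,−iθ_b)·H'_{ab} = r_{ab}·X'_{ab}` — the bookkeeping
step of `T4EMLTangentInjective.key`, isolated. [folklore] -/
theorem coef_of_dexp_eq_frame {U : Matrix m m ℂ} (hU : star U * U = 1) (hU' : U * star U = 1) (θ : m → ℝ)
    {Z : Matrix m m ℂ} (hZU : Z = U * diagonal (fun a => -I * (θ a : ℂ)) * star U) (X H : Matrix m m ℂ) (r : m → m → ℂ)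
    (hH : dexp Z H = U * Matrix.of (fun a b => r a b * (star U * X * U) a b) * star U) (a b : m) :
    dd (-I * θ a) (-I * θ b) * (star U * H * U) a b = r a b * (star U * X * U) a b := by
  have hl : ∀ a b, Z * Fu U a b = (-I * (θ a : ℂ)) • Fu U a b := fun a b => by
    rw [hZU]; exact frame_mul_Fu hU _ a b
  have hr' : ∀ a b, Fu U a b * Z = (-I * (θ b : ℂ)) • Fu U a b := fun a b => by
    rw [hZU]; exact Fu_mul_frame hU _ a b
  have hdexp : ∀ a b, dexp Z (Fu U a b) = dd (-I * θ a) (-I * θ b) • Fu U a b := fun a b =>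
    dexp_eigen (hl a b) (hr' a b)
  set X' : Matrix m m ℂ := star U * X * U with hX'
  set H' : Matrix m m ℂ := star U * H * U with hH'
  have hHU : H = U * H' * star U := (conj_unconj hU' H).symm
  have h1 : dexp Z H = U * Matrix.of (fun a b => dd (-I * θ a) (-I * θ b) * H' a b) * star U := by
    rw [hHU]; exact linmap_frame (dexp Z).toLinearMap _ hdexp H'
  have h3 := h1.symm.trans hH
  have h4 := congrArg (fun N => star U * N * U) h3
  simp only [unconj_conj hU] at h4
  have h5 := congrFun (congrFun h4 a) b
  simpa only [Matrix.of_apply] using h5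

/-- **The quadratic form of a solution**: under the same hypotheses and `|β_{ab}| < π` (so `dd ≠ 0`),
`hs(X, H) = Σ_{ab} |X'_{ab}|² · Re(r_{ab} ∕ dd(−iθₐ,−iθ_b))`. [folklore] -/
theorem hs_of_dexp_eq_frame {U : Matrix m m ℂ} (hU : star U * U = 1) (hU' : U * star U = 1) (θ : m → ℝ)
    (hβ : ∀ a b, |(θ a - θ b) / 2| < Real.pi) {Z : Matrix m m ℂ}
    (hZU : Z = U * diagonal (fun a => -I * (θ a : ℂ)) * star U) (X H : Matrix m m ℂ) (r : m → m → ℂ)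
    (hH : dexp Z H = U * Matrix.of (fun a b => r a b * (star U * X * U) a b) * star U) :
    hs X H = ∑ a, ∑ b, ‖(star U * X * U) a b‖ ^ 2 * (r a b / dd (-I * θ a) (-I * θ b)).re := by
  have hcoef := coef_of_dexp_eq_frame hU hU' θ hZU X H r hH
  set X' : Matrix m m ℂ := star U * X * U with hX'
  set H' : Matrix m m ℂ := star U * H * U with hH'
  have hXU : X = U * X' * star U := (conj_unconj hU' X).symm
  have hHU : H = U * H' * star U := (conj_unconj hU' H).symm
  rw [hXU, hHU, hs_frame hU]
  refine Finset.sum_congr rfl fun a _ => Finset.sum_congr rfl fun b _ => ?_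
  obtain ⟨hne, -⟩ := dd_ratio (hβ a b)
  have hH'ab : H' a b = r a b * X' a b / dd (-I * θ a) (-I * θ b) :=
    (eq_div_iff hne).2 (by rw [mul_comm]; exact hcoef a b)
  rw [hH'ab, show star (X' a b) * (r a b * X' a b / dd (-I * θ a) (-I * θ b))
      = (r a b / dd (-I * θ a) (-I * θ b)) * (star (X' a b) * X' a b) by ring,
    Complex.star_def, Complex.conj_mul', ← Complex.ofReal_pow, Complex.re_mul_ofReal, mul_comm]

omit [Nonempty m] in
/-- `exp Z · X` in the frame: coordinates `e^{−iθₐ}·X'_{ab}`. [folklore] -/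
theorem exp_mul_frame {U : Matrix m m ℂ} (hU : star U * U = 1) (hU' : U * star U = 1) (θ : m → ℝ)
    {Z : Matrix m m ℂ} (hZU : Z = U * diagonal (fun a => -I * (θ a : ℂ)) * star U) (X : Matrix m m ℂ) :
    exp Z * X = U * Matrix.of (fun a b => Complex.exp (-I * θ a) * (star U * X * U) a b) * star U := by
  have hl : ∀ a b, Z * Fu U a b = (-I * (θ a : ℂ)) • Fu U a b := fun a b => by
    rw [hZU]; exact frame_mul_Fu hU _ a b
  have hexp : ∀ a b, exp Z * Fu U a b = Complex.exp (-I * θ a) • Fu U a b := fun a b =>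
    exp_mul_of_eigen (hl a b)
  set X' : Matrix m m ℂ := star U * X * U with hX'
  have hXU : X = U * X' * star U := (conj_unconj hU' X).symm
  rw [hXU]
  exact linmap_frame (LinearMap.mulLeft ℂ (exp Z)) _ hexp X'

omit [Nonempty m] in
/-- `e^{Z∕2} · X · e^{Z∕2}` in the frame: coordinates `e^{−i(θₐ+θ_b)∕2}·X'_{ab}` (a unimodular multiplier). [folklore] -/
theorem exp_half_sandwich_frame {U : Matrix m m ℂ} (hU : star U * U = 1) (hU' : U * star U = 1) (θ : m → ℝ)
    {Z : Matrix m m ℂ} (hZU : Z = U * diagonal (fun a => -I * (θ a : ℂ)) * star U) (X : Matrix m m ℂ) :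
    exp ((2⁻¹ : ℂ) • Z) * X * exp ((2⁻¹ : ℂ) • Z)
      = U * Matrix.of (fun a b => Complex.exp ((-I * θ a + -I * θ b) / 2) * (star U * X * U) a b) * star U := by
  have hl : ∀ a b, ((2⁻¹ : ℂ) • Z) * Fu U a b = (2⁻¹ * (-I * (θ a : ℂ))) • Fu U a b := fun a b => by
    rw [smul_mul_assoc, hZU, frame_mul_Fu hU _ a b, smul_smul]
  have hr' : ∀ a b, Fu U a b * ((2⁻¹ : ℂ) • Z) = (2⁻¹ * (-I * (θ b : ℂ))) • Fu U a b := fun a b => by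
    rw [mul_smul_comm, hZU, Fu_mul_frame hU _ a b, smul_smul]
  set f : Matrix m m ℂ →ₗ[ℂ] Matrix m m ℂ :=
    (LinearMap.mulLeft ℂ (exp ((2⁻¹ : ℂ) • Z))) ∘ₗ (LinearMap.mulRight ℂ (exp ((2⁻¹ : ℂ) • Z))) with hf_def
  have hf : ∀ a b, f (Fu U a b) = Complex.exp ((-I * θ a + -I * θ b) / 2) • Fu U a b := by
    intro a b
    rw [hf_def, LinearMap.comp_apply, LinearMap.mulRight_apply, LinearMap.mulLeft_apply, mul_exp_of_eigen (hr' a b),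
      mul_smul_comm, exp_mul_of_eigen (hl a b), smul_smul, ← Complex.exp_add]
    congr 2
    ring
  set X' : Matrix m m ℂ := star U * X * U with hX'
  have hXU : X = U * X' * star U := (conj_unconj hU' X).symm
  have h := linmap_frame f _ hf X'
  rw [hf_def, LinearMap.comp_apply, LinearMap.mulRight_apply, LinearMap.mulLeft_apply] at h
  rw [hXU, Matrix.mul_assoc]
  exact h

/-- **The solution `H` of `dexp Z H = exp Z · X`** (skew-Hermitian `Z = U diag(−iθ) U*`): `hs(X, H) = Σ |X'_{ab}|²·(1 − ψ(β_{ab}))`,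
`β_{ab} = (θₐ − θ_b)∕2`, `1 − ψ(β) = β cot β` — the quadratic form of `φ(B_Z)`. [folklore] -/
theorem hs_solution_eq {U : Matrix m m ℂ} (hU : star U * U = 1) (hU' : U * star U = 1) (θ : m → ℝ)
    (hβ : ∀ a b, |(θ a - θ b) / 2| < Real.pi) {Z : Matrix m m ℂ}
    (hZU : Z = U * diagonal (fun a => -I * (θ a : ℂ)) * star U) (X H : Matrix m m ℂ)
    (hH : dexp Z H = exp Z * X) :
    hs X H = ∑ a, ∑ b, ‖(star U * X * U) a b‖ ^ 2 * (1 - ψ ((θ a - θ b) / 2)) := by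
  rw [hs_of_dexp_eq_frame hU hU' θ hβ hZU X H (fun a _ => Complex.exp (-I * θ a))
    (hH.trans (exp_mul_frame hU hU' θ hZU X))]
  refine Finset.sum_congr rfl fun a _ => Finset.sum_congr rfl fun b _ => ?_
  rw [(dd_ratio (hβ a b)).2]

/-- **The solution `G♭` of `dexp Z G♭ = e^{Z∕2} · X · e^{Z∕2}`**: `hs(X, G♭) = Σ |X'_{ab}|² · (sinc β_{ab})⁻¹` — the quadratic
form of `χ(B_Z) = |dexp Z|⁻¹ ∘ (unitary)`, `χ(β) = β∕sin β ≥ 1`. [folklore] -/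
theorem hs_flat_solution_eq {U : Matrix m m ℂ} (hU : star U * U = 1) (hU' : U * star U = 1) (θ : m → ℝ)
    (hβ : ∀ a b, |(θ a - θ b) / 2| < Real.pi) {Z : Matrix m m ℂ}
    (hZU : Z = U * diagonal (fun a => -I * (θ a : ℂ)) * star U) (X Gf : Matrix m m ℂ)
    (hGf : dexp Z Gf = exp ((2⁻¹ : ℂ) • Z) * X * exp ((2⁻¹ : ℂ) • Z)) :
    hs X Gf = ∑ a, ∑ b, ‖(star U * X * U) a b‖ ^ 2 * (Real.sinc ((θ a - θ b) / 2))⁻¹ := by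
  rw [hs_of_dexp_eq_frame hU hU' θ hβ hZU X Gf _ (hGf.trans (exp_half_sandwich_frame hU hU' θ hZU X))]
  refine Finset.sum_congr rfl fun a _ => Finset.sum_congr rfl fun b _ => ?_
  rw [exp_half_div_dd (hβ a b), Complex.ofReal_re]

/-- `hs(X, X) ≤ hs(X, G♭)`: the `χ`-metric dominates the Hilbert–Schmidt metric (`sinc ≤ 1`), so the sharp coercivity below
implies the plain one (`GuardJacobian.coercive`). [folklore] -/
theorem hs_self_le_hs_flat_solution {U : Matrix m m ℂ} (hU : star U * U = 1) (hU' : U * star U = 1) (θ : m → ℝ)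
    (hβ : ∀ a b, |(θ a - θ b) / 2| < Real.pi) {Z : Matrix m m ℂ}
    (hZU : Z = U * diagonal (fun a => -I * (θ a : ℂ)) * star U) (X Gf : Matrix m m ℂ)
    (hGf : dexp Z Gf = exp ((2⁻¹ : ℂ) • Z) * X * exp ((2⁻¹ : ℂ) • Z)) :
    hs X X ≤ hs X Gf := by
  rw [hs_flat_solution_eq hU hU' θ hβ hZU X Gf hGf]
  conv_lhs => rw [(conj_unconj hU' X).symm, hs_frame hU]
  refine Finset.sum_le_sum fun a _ => Finset.sum_le_sum fun b _ => ?_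
  rw [Complex.star_def, Complex.conj_mul', ← Complex.ofReal_pow, Complex.ofReal_re]
  have hβ0 : 0 < Real.sinc ((θ a - θ b) / 2) := by
    have h := norm_dd_eq (hβ a b); rw [← h]; exact norm_pos_iff.2 (dd_ratio (hβ a b)).1
  have h1 : 1 ≤ (Real.sinc ((θ a - θ b) / 2))⁻¹ := (one_le_inv₀ hβ0).2 (Real.sinc_le_one _)
  nlinarith [sq_nonneg ‖(star U * X * U) a b‖]

/-- **Twisted Cauchy–Schwarz in the frame.**  For skew-Hermitian `Z = U diag(−iθ) U*` (`|β_{ab}| < π`), any `G'`, and the flat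
solution `dexp Z G♭ = e^{Z∕2} X e^{Z∕2}`:  `hs(X, G')² ≤ hs(G♭, G♭) · hs(dexp Z G', dexp Z G')` — pair `dexp Z G'` with
`N = (dexp Z)^{−*} X` (frame coordinates `X'_{ab} ∕ conj dd_{ab}`), whose Hilbert–Schmidt norm is that of `G♭` (`|e^{(p+q)∕2}| = 1`). [folklore] -/
theorem hs_sq_le_frame {U : Matrix m m ℂ} (hU : star U * U = 1) (hU' : U * star U = 1) (θ : m → ℝ)
    (hβ : ∀ a b, |(θ a - θ b) / 2| < Real.pi) {Z : Matrix m m ℂ}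
    (hZU : Z = U * diagonal (fun a => -I * (θ a : ℂ)) * star U) (X G' Gf : Matrix m m ℂ)
    (hGf : dexp Z Gf = exp ((2⁻¹ : ℂ) • Z) * X * exp ((2⁻¹ : ℂ) • Z)) :
    hs X G' * hs X G' ≤ hs Gf Gf * hs (dexp Z G') (dexp Z G') := by
  have hl : ∀ a b, Z * Fu U a b = (-I * (θ a : ℂ)) • Fu U a b := fun a b => by
    rw [hZU]; exact frame_mul_Fu hU _ a b
  have hr' : ∀ a b, Fu U a b * Z = (-I * (θ b : ℂ)) • Fu U a b := fun a b => by
    rw [hZU]; exact Fu_mul_frame hU _ a b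
  have hdexp : ∀ a b, dexp Z (Fu U a b) = dd (-I * θ a) (-I * θ b) • Fu U a b := fun a b =>
    dexp_eigen (hl a b) (hr' a b)
  have hdd0 : ∀ a b, dd (-I * θ a) (-I * θ b) ≠ 0 := fun a b => (dd_ratio (hβ a b)).1
  have hcoef := coef_of_dexp_eq_frame hU hU' θ hZU X Gf _ (hGf.trans (exp_half_sandwich_frame hU hU' θ hZU X))
  set X' : Matrix m m ℂ := star U * X * U with hX'
  set G'' : Matrix m m ℂ := star U * G' * U with hG''
  set Gf' : Matrix m m ℂ := star U * Gf * U with hGf'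
  have hXU : X = U * X' * star U := (conj_unconj hU' X).symm
  have hG'U : G' = U * G'' * star U := (conj_unconj hU' G').symm
  have hGfU : Gf = U * Gf' * star U := (conj_unconj hU' Gf).symm
  set N : Matrix m m ℂ := U * Matrix.of (fun a b => star (star (X' a b) / dd (-I * θ a) (-I * θ b))) * star U with hN
  have h1 : dexp Z G' = U * Matrix.of (fun a b => dd (-I * θ a) (-I * θ b) * G'' a b) * star U := by
    rw [hG'U]; exact linmap_frame (dexp Z).toLinearMap _ hdexp G''
  -- (i) the twisted pairing reproduces `hs X G'`
  have hi : hs N (dexp Z G') = hs X G' := by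
    rw [h1, hN, hs_frame hU]
    conv_rhs => rw [hXU, hG'U, hs_frame hU]
    refine Finset.sum_congr rfl fun a _ => Finset.sum_congr rfl fun b _ => ?_
    rw [Matrix.of_apply, Matrix.of_apply, star_star, div_mul_eq_mul_div, mul_div_assoc,
      mul_div_cancel_left₀ _ (hdd0 a b)]
  -- (ii) `‖N‖ = ‖G♭‖`
  have hii : hs N N = hs Gf Gf := by
    rw [hN, hs_frame hU]
    conv_rhs => rw [hGfU, hs_frame hU]
    refine Finset.sum_congr rfl fun a _ => Finset.sum_congr rfl fun b _ => ?_
    have hab : Gf' a b = Complex.exp ((-I * θ a + -I * θ b) / 2) * X' a b / dd (-I * θ a) (-I * θ b) :=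
      (eq_div_iff (hdd0 a b)).2 (by rw [mul_comm]; exact hcoef a b)
    have hre : ((-I * (θ a : ℂ) + -I * θ b) / 2).re = 0 := by simp
    rw [Matrix.of_apply, Complex.star_def, Complex.conj_mul', Complex.conj_mul',
      ← Complex.ofReal_pow, ← Complex.ofReal_pow, Complex.ofReal_re, Complex.ofReal_re, Complex.norm_conj, norm_div,
      Complex.norm_conj, hab, norm_div, norm_mul, Complex.norm_exp, hre, Real.exp_zero, one_mul]
  calc hs X G' * hs X G' = hs N (dexp Z G') * hs N (dexp Z G') := by rw [hi]
    _ ≤ hs N N * hs (dexp Z G') (dexp Z G') := hs_mul_self_le _ _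
    _ = hs Gf Gf * hs (dexp Z G') (dexp Z G') := by rw [hii]

end Frame

end Summit.QuantumFields.YangMills.BalabanUVNodes.N08HaarCompatibilityGuardJacobianSharpFrame

end
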